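import Summits.CriticalPhenomena.PercolationContinuityZ3.Theorems.PercNearOneGluingNoHeavyQuantIndepBlobUnitCreditPair
import HarnessLib

/-!
# QUANT lane R8, T-DIB: the chord cells of the two-light certificate when the heavy mass is at most `j` — three explicit
# real inequalities (cells C5, C6, C7 of P1-SURPLUS §23.5)

builds on p205010 (kernel theorem, internal audit signed; external expert review pending)

Support file (`--supports stmt-CriticalPhenomena-4575`), QUANT lane seat prim-quant-p1 (gen 12); memo
`run/shared/lean/prim/quant/P1-SURPLUS.md` §23.5–23.7.  Theorems only (statements about real numbers); no definitions, no sorries,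
standard axioms.

SETTING (the pseudo-system behind a chord, `…QuantIndepBlobHeavyLine` / `…QuantIndepBlobPairChords`).  Floor `1/2 < x < 1`; two
sub-floor blobs: the BIG one of size `B` and gate `G = x² + (1−x)·a`, the SMALL one of size `b ≤ B` and gate `g = x² + (1−x)·c`, credit
rates `a, c ∈ [0, x)` (so `x² ≤ G, g < x`), sizes `b ≤ B ≤ j`; light credit `K = B·a + b·c`.  Heavy side: total size `A`, mean open
mass `m` with `x·A ≤ m` (heavy gates `≥ x`) and the DIB\* credit hypothesis `2j < m + K`.  A chord is a pair of integers
`n₁ < m < n₂ ≤ A`; its value is `(n₂ − m)·F(j+1−n₁) + (m − n₁)·F(j+1−n₂)` with `F` the tail of the light pair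
(`tailU_pair`: `F(t) = 1 − (1−G)(1−g) =: P₁` for `1 ≤ t ≤ b`, `= G` for `b < t ≤ B`, `= Gg` for `B < t ≤ B+b`).  When `A ≤ j`
(hence `n₂ ≤ j`) only three cells occur, and in all of them `a + c > 1` (the pair carries more than `j ≥ max size` units of credit):

* `Quant.IndepBlob.twoLight_unit_credit` — `m ≤ n₂ ≤ j` and `2j < m + B a + b c` with `b ≤ B ≤ j` force `1 < a + c`.
* `Quant.IndepBlob.twoLight_cellC7` — `F(n₁) = F(n₂) = P₁`: the chord value is `(n₂ − n₁)·P₁ ≥ x·(n₂ − n₁)`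
  (`lightPair_closure_of_unit_credit`).
* `Quant.IndepBlob.twoLight_cellC6` — `F(n₁) = G`, `F(n₂) = P₁` (cell `j+1−B ≤ n₁ ≤ j−b`): the credit bound
  `m − n₁ ≥ (2 − a − c)(n₂ − n₁)` and the elementary chain `(2−a−c)·g·(1+x−a) ≥ x − a`.
* `Quant.IndepBlob.twoLight_cellC5` — `F(n₁) = Gg`, `F(n₂) = P₁` (cell `n₁ ≤ j − B`, THE extremal cell of DIB\*): two lower bounds
  for `θ = (m − n₁)/(n₂ − n₁)` — `θ ≥ 2 − a − c` (credit) and `θ ≥ 1 − 2x(1−x)` (floor `m ≥ xA` plus `2x·n₁ < (2x−1)·n₂`, itself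
  from the credit) —, the symmetrisation `Gg + θ(G + g − 2Gg) ≥ θτ + (1−2θ)τ²/4` (`τ = G + g`, `θ ≥ 1/2`), and two polynomial
  inequalities in `(x, τ)` (`twoLight_polyA`, `twoLight_polyB`, found by `nlinarith`).
* `Quant.IndepBlob.twoLight_cellC5_zero` — the same cell with `n₁ = 0` (then `θ ≥ x`): `(1−x)Gg ≥ x(1−G)(1−g)` suffices
  (`lightPair_odds_of_unit_credit`); kept separately as the cleanest form of the extremal inequality.
Numerics (`prim-quant-p1-g12/evidence/num/e12_h4.py`, `e13c.py`, `e14*.py`): margins `≥ 0.22·(1−x)` (C5), `0.45` (C6), `0.5` (C7) on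
`8·10⁶` samples with `j ≤ 40`; the two polynomial facts hold with margin `≥ 0.12`.
[cite: KozmaNitzan2024, Conjecture 3 (p. 15)] (the gluing rows served); the lemmas are [this work].
-/

namespace Summit.CriticalPhenomena.PercolationContinuityZ3.Theorems

namespace Quant

namespace IndepBlob

/-! ### 0. Unit credit of the pair and two polynomial facts -/

/-- In the cells with `n₂ ≤ j` the two light blobs carry more than one unit of credit rate:
`m ≤ n₂ ≤ j`, `0 ≤ a, c`, `0 ≤ b ≤ B ≤ j` and `2j < m + B a + b c` give `1 < a + c`. [this work] -/
theorem twoLight_unit_credit (a c B b j n₂ m : ℝ) (ha0 : 0 ≤ a) (hc0 : 0 ≤ c) (hb0 : 0 ≤ b) (hbB : b ≤ B) (hBj : B ≤ j)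
    (hmn2 : m ≤ n₂) (hn2j : n₂ ≤ j) (hcr : 2 * j < m + (B * a + b * c)) : 1 < a + c := by
  have h1 : B * a ≤ j * a := mul_le_mul_of_nonneg_right hBj ha0
  have h2 : b * c ≤ j * c := mul_le_mul_of_nonneg_right (hbB.trans hBj) hc0
  have h3 : j < j * (a + c) := by nlinarith
  have hj : 0 ≤ j := by linarith
  by_contra h
  have h' : a + c ≤ 1 := not_lt.mp h
  have : j * (a + c) ≤ j * 1 := mul_le_mul_of_nonneg_left h' hj
  linarith

/-- **Polynomial fact A** (case `a + c ≤ 1 + 2x(1−x)` of cell C5): for `1/2 ≤ x < 1` and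
`2x² + (1−x) ≤ τ ≤ min(2x, 2x² + (1−x) + 2x(1−x)²)`:
`4(1−x)x ≤ 4(C₀ − τ)τ + ((1−x) − 2C₀ + 2τ)τ²`, `C₀ = 2 − 2x + 2x²` — i.e. `W((C₀−τ)/(1−x), τ) ≥ x` for
`W(θ, τ) = θτ + (1−2θ)τ²/4`. [this work] -/
theorem twoLight_polyA (x τ : ℝ) (hx : 1 / 2 ≤ x) (hx1 : x < 1)
    (hτlo : 2 * x ^ 2 + (1 - x) ≤ τ) (hτhi : τ ≤ 2 * x ^ 2 + (1 - x) + 2 * x * (1 - x) ^ 2) (hτ2 : τ ≤ 2 * x) :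
    4 * (1 - x) * x ≤ 4 * ((2 - 2 * x + 2 * x ^ 2) - τ) * τ + ((1 - x) - 2 * (2 - 2 * x + 2 * x ^ 2) + 2 * τ) * τ ^ 2 := by
  nlinarith [mul_nonneg (sub_nonneg.2 hτlo) (sub_nonneg.2 hτhi), mul_nonneg (sub_nonneg.2 hx) (sub_nonneg.2 hx1.le),
    sq_nonneg (x - 7 / 10), mul_nonneg (sub_nonneg.2 hτlo) (sub_nonneg.2 hx1.le), mul_nonneg (sub_nonneg.2 hτhi) (sub_nonneg.2 hx1.le),
    mul_nonneg (sub_nonneg.2 hτ2) (sub_nonneg.2 hx1.le), mul_nonneg (sub_nonneg.2 hτlo) (sub_nonneg.2 hτ2),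
    mul_nonneg (mul_nonneg (sub_nonneg.2 hτlo) (sub_nonneg.2 hτhi)) (sub_nonneg.2 hx1.le),
    mul_nonneg (mul_nonneg (sub_nonneg.2 hτlo) (sub_nonneg.2 hτ2)) (sub_nonneg.2 hx1.le),
    mul_nonneg (mul_nonneg (sub_nonneg.2 hx) (sub_nonneg.2 hx1.le)) (sub_nonneg.2 hτhi)]

/-- **Polynomial fact B** (case `a + c ≥ 1 + 2x(1−x)` of cell C5): for `1/2 ≤ x ≤ 1` and
`2x² + (1−x) + 2x(1−x)² ≤ τ ≤ 2x`, with `θ_b = 1 − 2x(1−x)`: `x ≤ θ_b τ + (1 − 2θ_b)τ²/4`. [this work] -/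
theorem twoLight_polyB (x τ : ℝ) (hx : 1 / 2 ≤ x) (hx1 : x ≤ 1)
    (hτlo : 2 * x ^ 2 + (1 - x) + 2 * x * (1 - x) ^ 2 ≤ τ) (hτhi : τ ≤ 2 * x) :
    x ≤ (1 - 2 * x * (1 - x)) * τ + (1 - 2 * (1 - 2 * x * (1 - x))) * τ ^ 2 / 4 := by
  nlinarith [mul_nonneg (sub_nonneg.2 hτlo) (sub_nonneg.2 hτhi), mul_nonneg (sub_nonneg.2 hx) (sub_nonneg.2 hx1),
    sq_nonneg (x - 7 / 10), sq_nonneg (x ^ 2 - 1 / 2), mul_nonneg (sub_nonneg.2 hτlo) (sub_nonneg.2 hx1),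
    mul_nonneg (sub_nonneg.2 hτhi) (sub_nonneg.2 hx1), sq_nonneg (τ - 2 * x), sq_nonneg (x - 1 / 2),
    mul_nonneg (mul_nonneg (sub_nonneg.2 hx) (sub_nonneg.2 hx1)) (sub_nonneg.2 hτhi),
    mul_nonneg (mul_nonneg (sub_nonneg.2 hx) (sub_nonneg.2 hx1)) (sub_nonneg.2 hτlo)]

/-! ### 1. Cell C7: both chord ends in the top light level -/

/-- **Cell C7** (`F(n₁) = F(n₂) = P₁ = 1 − (1−G)(1−g)`).  With `m ≤ n₂ ≤ j`, `b ≤ B ≤ j`, `a, c ∈ [0, x]`, `2j < m + B a + b c`: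
`x(n₂ − n₁) ≤ (n₂ − m)P₁ + (m − n₁)P₁`. [this work] -/
theorem twoLight_cellC7 (x a c G g B b j n₁ n₂ m : ℝ) (hx : 1 / 2 < x) (hx1 : x < 1)
    (ha0 : 0 ≤ a) (hax : a ≤ x) (hc0 : 0 ≤ c) (hcx : c ≤ x) (hG : G = x ^ 2 + (1 - x) * a) (hg : g = x ^ 2 + (1 - x) * c)
    (hb0 : 0 ≤ b) (hbB : b ≤ B) (hBj : B ≤ j) (hn1 : n₁ ≤ n₂) (hmn2 : m ≤ n₂) (hn2j : n₂ ≤ j)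
    (hcr : 2 * j < m + (B * a + b * c)) :
    x * (n₂ - n₁) ≤ (n₂ - m) * (1 - (1 - G) * (1 - g)) + (m - n₁) * (1 - (1 - G) * (1 - g)) := by
  have hσ : 1 < a + c := twoLight_unit_credit a c B b j n₂ m ha0 hc0 hb0 hbB hBj hmn2 hn2j hcr
  have hε : 0 < 1 - x := by linarith
  have hGx : G ≤ x := by rw [hG]; nlinarith
  have hgx : g ≤ x := by rw [hg]; nlinarith
  have hcr' : 1 - x ≤ (G - x ^ 2) + (g - x ^ 2) := by rw [hG, hg]; nlinarith
  have hcl := lightPair_closure_of_unit_credit x G g hx.le hx1 hGx hgx hcr'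
  have hP : x ≤ 1 - (1 - G) * (1 - g) := by linarith
  nlinarith [mul_le_mul_of_nonneg_left hP (sub_nonneg.2 hn1)]

/-! ### 2. Cell C6: lower chord end in the big-light level -/

/-- The elementary chain of cell C6: for `1/2 ≤ x ≤ 1`, `a, c ∈ [0, x]`, `g = x² + (1−x)c`:
`x − a ≤ (2 − a − c)·g·(1 + x − a)`.  (`2 − a − c ≥ (x − a) + 2(1 − x)`, `g ≥ x²`, and
`2x² − α(1 + x − 2x²) ≥ x(2x−1)(x+1) ≥ 0` for `α = x − a ≤ x`.) [this work] -/
theorem twoLight_chainC6 (x a c g : ℝ) (hx : 1 / 2 ≤ x) (hx1 : x ≤ 1) (ha0 : 0 ≤ a) (hax : a ≤ x) (hc0 : 0 ≤ c)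
    (hcx : c ≤ x) (hg : g = x ^ 2 + (1 - x) * c) :
    x - a ≤ (2 - a - c) * g * (1 + x - a) := by
  have hg0 : x ^ 2 ≤ g := by rw [hg]; nlinarith
  have h2 : (x - a) + 2 * (1 - x) ≤ 2 - a - c := by linarith
  have hα0 : 0 ≤ x - a := by linarith
  have h1a : 0 ≤ 1 + x - a := by linarith
  -- `(2 − a − c) g (1+x−a) ≥ ((x−a) + 2(1−x))·x²·(1 + (x − a))`
  have step1 : ((x - a) + 2 * (1 - x)) * x ^ 2 * (1 + x - a) ≤ (2 - a - c) * g * (1 + x - a) := by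
    have := mul_le_mul h2 hg0 (sq_nonneg x) (by linarith)
    exact mul_le_mul_of_nonneg_right this h1a
  -- and the left side dominates `x − a`
  have step2 : x - a ≤ ((x - a) + 2 * (1 - x)) * x ^ 2 * (1 + x - a) := by
    nlinarith [mul_nonneg hα0 hα0, mul_nonneg (mul_nonneg hα0 hα0) (sq_nonneg x), mul_nonneg hα0 (sub_nonneg.2 hx),
      mul_nonneg (sub_nonneg.2 hax) (sub_nonneg.2 hx1), mul_nonneg (mul_nonneg (sub_nonneg.2 hax) (sub_nonneg.2 hx1)) (sub_nonneg.2 hx),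
      mul_nonneg (sub_nonneg.2 hx1) (sub_nonneg.2 hx), mul_nonneg hα0 (sub_nonneg.2 hx1)]
  linarith

/-- **Cell C6** (`F(n₁) = G`, `F(n₂) = P₁`; cell `j + 1 − B ≤ n₁ ≤ j − b`, `n₂ ≤ j`).  With `0 ≤ n₁ < n₂`, `n₁ ≤ m`,
`a, c ∈ [0, x]`, `b ≤ B ≤ j` (real sizes, `0 ≤ b`), and `2j < m + B a + b c`:
`x(n₂ − n₁) ≤ (n₂ − m)·G + (m − n₁)·P₁`.  Proof: `m − n₁ > 2j − n₁ − B a − b c ≥ (j − n₁)(2 − a − c) ≥ (n₂ − n₁)(2 − a − c)`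
(`B ≤ j`, `b ≤ j − n₁`), `P₁ − G = (1−G)g ≥ 0`, and `twoLight_chainC6`. [this work] -/
theorem twoLight_cellC6 (x a c G g B b j n₁ n₂ m : ℝ) (hx : 1 / 2 < x) (hx1 : x < 1)
    (ha0 : 0 ≤ a) (hax : a ≤ x) (hc0 : 0 ≤ c) (hcx : c ≤ x) (hG : G = x ^ 2 + (1 - x) * a) (hg : g = x ^ 2 + (1 - x) * c)
    (hBj : B ≤ j) (hn10 : 0 ≤ n₁) (hn1 : n₁ < n₂) (hn2j : n₂ ≤ j)
    (hcellhi : n₁ ≤ j - b) (hcr : 2 * j < m + (B * a + b * c)) :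
    x * (n₂ - n₁) ≤ (n₂ - m) * G + (m - n₁) * (1 - (1 - G) * (1 - g)) := by
  have hε : 0 < 1 - x := by linarith
  -- credit bound on `m − n₁`
  have hK : B * a + b * c ≤ j * a + (j - n₁) * c := by
    have e1 := mul_le_mul_of_nonneg_right hBj ha0
    have hb' : b ≤ j - n₁ := by linarith
    have e2 := mul_le_mul_of_nonneg_right hb' hc0
    linarith
  have hθ : (2 - a - c) * (n₂ - n₁) ≤ m - n₁ := by
    have h2σ : 0 ≤ 2 - a - c := by linarith
    have h1 : (2 - a - c) * (n₂ - n₁) ≤ (2 - a - c) * (j - n₁) := mul_le_mul_of_nonneg_left (by linarith) h2σ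
    nlinarith [mul_nonneg hn10 (sub_nonneg.2 (show a ≤ 1 by linarith))]
  -- `P₁ − G = (1 − G) g ≥ 0`
  have hPG : 1 - (1 - G) * (1 - g) - G = (1 - G) * g := by ring
  have h1G : 0 ≤ 1 - G := by rw [hG]; nlinarith
  have hg0 : 0 ≤ g := by rw [hg]; nlinarith
  have hD : 0 ≤ (1 - G) * g := mul_nonneg h1G hg0
  -- rewrite the claim
  have hid : (n₂ - m) * G + (m - n₁) * (1 - (1 - G) * (1 - g)) - x * (n₂ - n₁) =
      (n₂ - n₁) * (G - x) + (m - n₁) * ((1 - G) * g) := by ring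
  have hchain := twoLight_chainC6 x a c g hx.le hx1.le ha0 hax hc0 hcx hg
  -- `(G − x) + (2 − a − c)(1−G)g = (1−x)[(2−a−c) g (1+x−a) − (x − a)] ≥ 0`
  have hbr : 0 ≤ (G - x) + (2 - a - c) * ((1 - G) * g) := by
    have e1 : (G - x) + (2 - a - c) * ((1 - G) * g) = (1 - x) * ((2 - a - c) * g * (1 + x - a) - (x - a)) := by
      rw [hG]; ring
    rw [e1]
    exact mul_nonneg hε.le (by linarith)
  have hmain : 0 ≤ (n₂ - n₁) * (G - x) + (m - n₁) * ((1 - G) * g) := by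
    have hd0 : 0 ≤ n₂ - n₁ := by linarith
    have := mul_le_mul_of_nonneg_right hθ hD
    nlinarith [mul_nonneg hd0 hbr]
  linarith [hid, hmain]

/-! ### 3. Cell C5: lower chord end in the both-lights level (the extremal cell) -/

/-- **Cell C5 with `n₁ = 0`** (`F(0) = Gg`, `F(n₂) = P₁`, `m ≥ xA ≥ x n₂`): `x·n₂ ≤ (n₂ − m)·Gg + m·P₁` — by
`lightPair_odds_of_unit_credit` (`(1−x)Gg ≥ x(1−G)(1−g)` under unit credit). [this work] -/
theorem twoLight_cellC5_zero (x a c G g B b j n₂ A m : ℝ) (hx : 1 / 2 < x) (hx1 : x < 1)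
    (ha0 : 0 ≤ a) (hax : a ≤ x) (hc0 : 0 ≤ c) (hcx : c ≤ x) (hG : G = x ^ 2 + (1 - x) * a) (hg : g = x ^ 2 + (1 - x) * c)
    (hb0 : 0 ≤ b) (hbB : b ≤ B) (hBj : B ≤ j) (hmn2 : m ≤ n₂) (hn2j : n₂ ≤ j) (hAn2 : n₂ ≤ A) (hmA : x * A ≤ m)
    (hcr : 2 * j < m + (B * a + b * c)) :
    x * n₂ ≤ (n₂ - m) * (G * g) + m * (1 - (1 - G) * (1 - g)) := by
  have hσ : 1 < a + c := twoLight_unit_credit a c B b j n₂ m ha0 hc0 hb0 hbB hBj hmn2 hn2j hcr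
  have hε : 0 < 1 - x := by linarith
  have hGlo : x ^ 2 ≤ G := by rw [hG]; nlinarith
  have hglo : x ^ 2 ≤ g := by rw [hg]; nlinarith
  have hGx : G ≤ x := by rw [hG]; nlinarith
  have hgx : g ≤ x := by rw [hg]; nlinarith
  have hcr' : 1 - x ≤ (G - x ^ 2) + (g - x ^ 2) := by rw [hG, hg]; nlinarith
  have hodds := lightPair_odds_of_unit_credit x G g hx.le hx1 hGlo hGx hglo hgx hcr'
  have hm : x * n₂ ≤ m := by nlinarith
  -- `P₁ − Gg ≥ 0`
  have hD : 0 ≤ 1 - (1 - G) * (1 - g) - G * g := by nlinarith [mul_nonneg (sub_nonneg.2 hGx) (sub_nonneg.2 hgx)]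
  -- value ≥ its value at `m = x n₂`, which is `n₂[(1−x)Gg + x P₁] ≥ n₂ x`
  have hid : (n₂ - m) * (G * g) + m * (1 - (1 - G) * (1 - g)) =
      n₂ * (G * g) + m * (1 - (1 - G) * (1 - g) - G * g) := by ring
  rw [hid]
  have hn2 : 0 ≤ n₂ := by nlinarith
  have h1 : n₂ * (G * g) + (x * n₂) * (1 - (1 - G) * (1 - g) - G * g) ≤
      n₂ * (G * g) + m * (1 - (1 - G) * (1 - g) - G * g) := by nlinarith [mul_le_mul_of_nonneg_right hm hD]
  have h2 : x * n₂ ≤ n₂ * (G * g) + (x * n₂) * (1 - (1 - G) * (1 - g) - G * g) := by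
    have e : n₂ * (G * g) + (x * n₂) * (1 - (1 - G) * (1 - g) - G * g) - x * n₂ =
        n₂ * ((1 - x) * G * g - x * (1 - G) * (1 - g)) := by ring
    nlinarith [mul_nonneg hn2 (sub_nonneg.2 hodds)]
  linarith

/-- The symmetrisation step of cell C5: if `θ₀ ≥ 1/2`, `θ₀(n₂ − n₁) ≤ m − n₁` and `W(θ₀, G+g) ≥ x` for
`W(θ, τ) = θτ + (1−2θ)τ²/4`, then `x(n₂ − n₁) ≤ (n₂ − m)Gg + (m − n₁)(1 − (1−G)(1−g))` (`Gg ≤ (G+g)²/4`, `D = G + g − 2Gg ≥ 0`).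
[this work] -/
theorem twoLight_cellC5_finish (x G g n₁ n₂ m θ₀ : ℝ) (hd : 0 ≤ n₂ - n₁) (hD : 0 ≤ G + g - 2 * G * g)
    (hsq : 0 ≤ (G + g) ^ 2 / 4 - G * g) (hθ₀ : 1 / 2 ≤ θ₀) (hθm : θ₀ * (n₂ - n₁) ≤ m - n₁)
    (hW : x ≤ θ₀ * (G + g) + (1 - 2 * θ₀) * (G + g) ^ 2 / 4) :
    x * (n₂ - n₁) ≤ (n₂ - m) * (G * g) + (m - n₁) * (1 - (1 - G) * (1 - g)) := by
  have e : G * g + θ₀ * (G + g - 2 * G * g) - (θ₀ * (G + g) + (1 - 2 * θ₀) * (G + g) ^ 2 / 4) =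
      (2 * θ₀ - 1) * ((G + g) ^ 2 / 4 - G * g) := by ring
  have h2θ : 0 ≤ 2 * θ₀ - 1 := by linarith
  have h3 : 0 ≤ (2 * θ₀ - 1) * ((G + g) ^ 2 / 4 - G * g) := mul_nonneg h2θ hsq
  have hbr : 0 ≤ G * g - x + θ₀ * (G + g - 2 * G * g) := by linarith
  have h1 : θ₀ * (n₂ - n₁) * (G + g - 2 * G * g) ≤ (m - n₁) * (G + g - 2 * G * g) :=
    mul_le_mul_of_nonneg_right hθm hD
  have h2 : 0 ≤ (n₂ - n₁) * (G * g - x + θ₀ * (G + g - 2 * G * g)) := mul_nonneg hd hbr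
  have e2 : (n₂ - n₁) * (G * g - x + θ₀ * (G + g - 2 * G * g)) =
      (n₂ - n₁) * (G * g - x) + θ₀ * (n₂ - n₁) * (G + g - 2 * G * g) := by ring
  have hid : (n₂ - m) * (G * g) + (m - n₁) * (1 - (1 - G) * (1 - g)) - x * (n₂ - n₁) =
      (n₂ - n₁) * (G * g - x) + (m - n₁) * (G + g - 2 * G * g) := by ring
  linarith [h1, h2, e2, hid, h3, e]

/-- Case A of cell C5 (`1 ≤ a + c ≤ 1 + 2x(1−x)`, credit bound `θ ≥ 2 − a − c`). [this work] -/
theorem twoLight_cellC5_caseA (x a c G g n₁ n₂ m : ℝ) (hx : 1 / 2 < x) (hx1 : x < 1)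
    (hax : a ≤ x) (hcx : c ≤ x) (hG : G = x ^ 2 + (1 - x) * a) (hg : g = x ^ 2 + (1 - x) * c)
    (hd : 0 ≤ n₂ - n₁) (hD : 0 ≤ G + g - 2 * G * g) (hsq : 0 ≤ (G + g) ^ 2 / 4 - G * g)
    (hσ : 1 ≤ a + c) (hcase : a + c ≤ 1 + 2 * x * (1 - x)) (hθ1 : (2 - a - c) * (n₂ - n₁) ≤ m - n₁) :
    x * (n₂ - n₁) ≤ (n₂ - m) * (G * g) + (m - n₁) * (1 - (1 - G) * (1 - g)) := by
  have hε : 0 < 1 - x := by linarith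
  have h4x : 2 * x * (1 - x) ≤ 1 / 2 := by nlinarith [sq_nonneg (2 * x - 1)]
  have hθ1' : 1 / 2 ≤ 2 - a - c := by linarith
  have hτeq : G + g = 2 * x ^ 2 + (1 - x) * (a + c) := by rw [hG, hg]; ring
  have hτ2x : G + g ≤ 2 * x := by
    have := mul_le_mul_of_nonneg_left (show a + c ≤ 2 * x by linarith) hε.le
    rw [hτeq]; nlinarith [this]
  have hτlo : 2 * x ^ 2 + (1 - x) ≤ G + g := by
    have := mul_le_mul_of_nonneg_left hσ hε.le
    rw [hτeq]; linarith [this]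
  have hτhi : G + g ≤ 2 * x ^ 2 + (1 - x) + 2 * x * (1 - x) ^ 2 := by
    have := mul_le_mul_of_nonneg_left hcase hε.le
    have e : (1 - x) * (1 + 2 * x * (1 - x)) = (1 - x) + 2 * x * (1 - x) ^ 2 := by ring
    rw [hτeq]; linarith [this, e]
  have hpoly := twoLight_polyA x (G + g) hx.le hx1 hτlo hτhi hτ2x
  have e : 4 * ((2 - 2 * x + 2 * x ^ 2) - (G + g)) * (G + g) +
      ((1 - x) - 2 * (2 - 2 * x + 2 * x ^ 2) + 2 * (G + g)) * (G + g) ^ 2 =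
      4 * (1 - x) * ((2 - a - c) * (G + g) + (1 - 2 * (2 - a - c)) * (G + g) ^ 2 / 4) := by
    rw [hτeq]; ring
  rw [e] at hpoly
  have h4 : (0 : ℝ) < 4 * (1 - x) := by linarith
  have hW : x ≤ (2 - a - c) * (G + g) + (1 - 2 * (2 - a - c)) * (G + g) ^ 2 / 4 := le_of_mul_le_mul_left hpoly h4
  exact twoLight_cellC5_finish x G g n₁ n₂ m (2 - a - c) hd hD hsq hθ1' hθ1 hW

/-- Case B of cell C5 (`a + c ≥ 1 + 2x(1−x)`, floor bound `θ ≥ 1 − 2x(1−x)`). [this work] -/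
theorem twoLight_cellC5_caseB (x a c G g n₁ n₂ m : ℝ) (hx : 1 / 2 < x) (hx1 : x < 1)
    (hax : a ≤ x) (hcx : c ≤ x) (hG : G = x ^ 2 + (1 - x) * a) (hg : g = x ^ 2 + (1 - x) * c)
    (hd : 0 ≤ n₂ - n₁) (hD : 0 ≤ G + g - 2 * G * g) (hsq : 0 ≤ (G + g) ^ 2 / 4 - G * g)
    (hcase : 1 + 2 * x * (1 - x) ≤ a + c) (hθ2 : (1 - 2 * x * (1 - x)) * (n₂ - n₁) ≤ m - n₁) :
    x * (n₂ - n₁) ≤ (n₂ - m) * (G * g) + (m - n₁) * (1 - (1 - G) * (1 - g)) := by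
  have hε : 0 < 1 - x := by linarith
  have h4x : 2 * x * (1 - x) ≤ 1 / 2 := by nlinarith [sq_nonneg (2 * x - 1)]
  have hθb : 1 / 2 ≤ 1 - 2 * x * (1 - x) := by linarith
  have hτeq : G + g = 2 * x ^ 2 + (1 - x) * (a + c) := by rw [hG, hg]; ring
  have hτ2x : G + g ≤ 2 * x := by
    have := mul_le_mul_of_nonneg_left (show a + c ≤ 2 * x by linarith) hε.le
    rw [hτeq]; nlinarith [this]
  have hτlo : 2 * x ^ 2 + (1 - x) + 2 * x * (1 - x) ^ 2 ≤ G + g := by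
    have := mul_le_mul_of_nonneg_left hcase hε.le
    have e : (1 - x) * (1 + 2 * x * (1 - x)) = (1 - x) + 2 * x * (1 - x) ^ 2 := by ring
    rw [hτeq]; linarith [this, e]
  have hW := twoLight_polyB x (G + g) hx.le hx1.le hτlo hτ2x
  exact twoLight_cellC5_finish x G g n₁ n₂ m (1 - 2 * x * (1 - x)) hd hD hsq hθb hθ2 hW

/-- **Cell C5** (`F(n₁) = Gg`, `F(n₂) = P₁`; cell `n₁ ≤ j − B`, `n₂ ≤ j`).  With `0 ≤ n₁ < m < n₂ ≤ A`, `x·A ≤ m`,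
`a, c ∈ [0, x)`, `0 ≤ b ≤ B`, and `2j < m + B a + b c`: `x(n₂ − n₁) ≤ (n₂ − m)·Gg + (m − n₁)·P₁`.
Proof: `θ = (m−n₁)/(n₂−n₁)` satisfies `θ ≥ 2 − a − c` (credit, `B ≤ j − n₁`) and `θ ≥ 1 − 2x(1−x)` (`m ≥ x n₂` and
`2x n₁ < (2x−1) n₂`, from `B > (2j − n₂)/(2x)`); then `Gg − x + θ(G + g − 2Gg) ≥ θτ + (1−2θ)τ²/4 − x ≥ 0` (`τ = G + g`,
`θ ≥ 1/2`; `twoLight_polyA` for `a + c ≤ 1 + 2x(1−x)`, `twoLight_polyB` otherwise). [this work] -/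
theorem twoLight_cellC5 (x a c G g B b j n₁ n₂ A m : ℝ) (hx : 1 / 2 < x) (hx1 : x < 1)
    (ha0 : 0 ≤ a) (hax : a < x) (hc0 : 0 ≤ c) (hcx : c < x) (hG : G = x ^ 2 + (1 - x) * a) (hg : g = x ^ 2 + (1 - x) * c)
    (hb0 : 0 ≤ b) (hbB : b ≤ B) (hn10 : 0 ≤ n₁) (hn1m : n₁ < m) (hmn2 : m < n₂) (hn2j : n₂ ≤ j) (hAn2 : n₂ ≤ A)
    (hmA : x * A ≤ m) (hcellhi : n₁ ≤ j - B) (hcr : 2 * j < m + (B * a + b * c)) :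
    x * (n₂ - n₁) ≤ (n₂ - m) * (G * g) + (m - n₁) * (1 - (1 - G) * (1 - g)) := by
  have hε : 0 < 1 - x := by linarith
  have hd : 0 < n₂ - n₁ := by linarith
  have hGx : G ≤ x := by
    have := mul_le_mul_of_nonneg_left hax.le hε.le
    rw [hG]; nlinarith
  have hgx : g ≤ x := by
    have := mul_le_mul_of_nonneg_left hcx.le hε.le
    rw [hg]; nlinarith
  have hG0 : 0 ≤ G := by rw [hG]; positivity
  have hg0 : 0 ≤ g := by rw [hg]; positivity
  -- (ii) credit: `m − n₁ ≥ (2 − a − c)(n₂ − n₁)`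
  have hK : B * a + b * c ≤ (j - n₁) * (a + c) := by
    have hBj' : B ≤ j - n₁ := by linarith
    have hBb : b ≤ j - n₁ := hbB.trans hBj'
    have e1 := mul_le_mul_of_nonneg_right hBj' ha0
    have e2 := mul_le_mul_of_nonneg_right hBb hc0
    nlinarith [e1, e2]
  have hθ1 : (2 - a - c) * (n₂ - n₁) ≤ m - n₁ := by
    have h2σ : 0 ≤ 2 - a - c := by linarith
    have h1 : (2 - a - c) * (n₂ - n₁) ≤ (2 - a - c) * (j - n₁) := mul_le_mul_of_nonneg_left (by linarith) h2σ
    nlinarith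
  -- (i) floor: `2x n₁ ≤ (2x − 1) n₂`, hence `m − n₁ ≥ (1 − 2x(1−x))(n₂ − n₁)`
  have hB : 2 * j - n₂ < 2 * x * B := by
    have e1 : B * a ≤ B * x := mul_le_mul_of_nonneg_left hax.le (le_trans hb0 hbB)
    have e2 : b * c ≤ b * x := mul_le_mul_of_nonneg_left hcx.le hb0
    have e3 : b * x ≤ B * x := mul_le_mul_of_nonneg_right hbB (by linarith)
    linarith
  have hn1n2 : 2 * x * n₁ ≤ (2 * x - 1) * n₂ := by
    have e1 : 2 * x * n₁ ≤ 2 * x * (j - B) := mul_le_mul_of_nonneg_left hcellhi (by linarith)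
    nlinarith
  have hθ2 : (1 - 2 * x * (1 - x)) * (n₂ - n₁) ≤ m - n₁ := by nlinarith
  -- `D = G + g − 2Gg ≥ 0`
  have hg1 : 0 ≤ 1 - g := by linarith
  have hG1 : 0 ≤ 1 - G := by linarith
  have hD : 0 ≤ G + g - 2 * G * g := by nlinarith [mul_nonneg hG0 hg1, mul_nonneg hg0 hG1]
  have hsq : 0 ≤ (G + g) ^ 2 / 4 - G * g := by nlinarith [sq_nonneg (G - g)]
  -- `a + c ≥ 1`: otherwise `θ ≥ 2 − a − c > 1`, impossible since `m < n₂`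
  have hσ : 1 ≤ a + c := by
    by_contra h
    have h' : a + c < 1 := not_le.mp h
    have h1 : (2 - a - c) * (n₂ - n₁) < 1 * (n₂ - n₁) := by linarith
    have h2 : 2 - a - c < 1 := lt_of_mul_lt_mul_right h1 hd.le
    linarith
  by_cases hcase : a + c ≤ 1 + 2 * x * (1 - x)
  · exact twoLight_cellC5_caseA x a c G g n₁ n₂ m hx hx1 hax.le hcx.le hG hg hd.le hD hsq hσ hcase hθ1
  · exact twoLight_cellC5_caseB x a c G g n₁ n₂ m hx hx1 hax.le hcx.le hG hg hd.le hD hsq (not_le.mp hcase).le hθ2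

end IndepBlob

end Quant

end Summit.CriticalPhenomena.PercolationContinuityZ3.Theorems
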